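import HarnessLib

/-!
# BirchSwinnertonDyer — rank ≥ 2 observatory: gen-7/gen-8 joins of the anom census (height-free unit-cell instrument J9,
Kurihara-lane refresh g8, gen-8 Ш-parts ledger with the separately listed height-free class) — DATA

HONEST FRAMING: per-curve certified theorems and census instruments; no claim on BSD in rank ≥ 2.

CENSUS DATA ONLY (REFEREE P6/R7: DATA-labelled `def`s, never theorems about elliptic curves). Companion of
`Rank2ObservatoryAnomJoins4` / `Rank2ObservatoryAnomHeightFree` (same sources and conventions): every `def` transcribes a number
printed in `run/shared/lean/b2b/bsd-rank2-observatory/b2b-bsdr2-anom/CONSISTENCY-JOINS.md` §J9, §J9-g8, §J4-g8 (+ addendum) and §J7-g8,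
and its machine-readable source under `b2b-bsdr2-anom/joins-outputs/` (`JOIN-HEIGHTFREE[-g8].summary.json`, `JOIN-KURIHARA-g8.summary.json`,
`JOIN-KURIHARA-LOCAL-g8.summary.json`, `j5impl2-j107961/J5-IMPL2-AGREEMENT.json`, `JOIN-KURIHARA-PADIC-g8.summary.json`, `REFRESH-REGRESSION-g8.json`,
`REFRESH-REGRESSION-g6-g8.json`, `SHA-PARTS-LEDGER-g8.summary.json`; sha256 of every input recorded in each summary; re-verified by
`b2b-bsdr2-anom/MANIFEST-CHECK.md`). The census verdicts are unchanged: 358 159 rows consistent, anomalies under verification 0. The J9 rows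
are per-cell conclusions of the tree theorem `AtlasCurve(3).heightFreeRow` GIVEN named Literature facts (Kato 2004 Thm 17.4; Schneider 1985 /
Perrin-Riou) and census inputs — the ledger lists them APART from the unconditional class and the two are never merged; the `GRH_BNF` token
is conditional and never counted as unconditional. The `example`s are bookkeeping identities by `decide`.
-/

namespace Summit.BirchSwinnertonDyer.BirchSwinnertonDyer.Rank2Observatory.AnomJoins5

/-! ## J9 / J9-g8 — the height-free unit-cell instrument (`code/b2b-bsdr2-anom/joins/join_heightfree.py`)

For every cell `(E, p)` of padic-1's kernel-checked atlas (`Rank2ObservatoryPadicAtlas*.lean`, p ≥ 5 good ordinary, symbol certificate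
`(n, A, H, L)` with `check = true` by `decide`): the unit flag `p ∤ A·H − L ∧ p ∤ a_p − 1` two ways (kernel data vs engine A's `[T^r]P_n`),
the census inputs the row theorem needs (ρ̄ surjective by the galrep table AND own Serre-Prop.-19 witnesses, `p ∤ Tam` two engines,
`p ∤ #tors`), and — on the CLEAN unit cells — the prediction `ord_p Reg_p = r`, `#Ш[p^∞] = 1` against every engine that DID compute p-adic
heights (DIFF vA/vB, ShaA/ShaB, LSIDE) and against the Kurihara lane (J4-g6) at the same `(E, p)`. Gen 7 = 79 atlas files (table of
record `JOIN-HEIGHTFREE.*`); gen 8 = the unchanged script after the 80th part `R3A18` landed (`JOIN-HEIGHTFREE-g8.*`). -/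

/-- DATA (not a theorem): one run of J9: atlas files / `AtlasCurve(3)` defs / distinct curves; cells (by rank, by prime); cells whose unit
flag agrees between kernel data and engine A; clean unit cells (by rank, by prime) and their distinct curves; cells not applicable because
anomalous / non-unit / `p ∣ Tam` / galrep non-surjective / surjectivity not certified (reasons may overlap); non-anomalous cells with
`p ∤ #tors` (T); clean cells on which every available engine value agrees with the prediction (P) and the number of values compared; clean
cells with / without a Kurihara-lane certificate at the same `(E, p)`; verdict consistent; anomalies under verification; output sha. -/
structure HeightFreeJoin where
  (atlasFiles atlasDefs atlasCurves cells cellsRankTwo cellsRankThree : Nat)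
  (pFive pSeven pEleven pThirteen unitAgree cleanUnitCells : Nat)
  (cleanRankTwo cleanRankThree cleanPFive cleanPSeven cleanPEleven cleanPThirteen : Nat)
  (cleanUnitCurves naAnomalous naNonUnit naPTam naGalrepNonsurjective naSurjNotCertified : Nat)
  (tPass pPass pCheckedValues kuriharaBoth kuriharaHeightFreeOnly consistent : Nat)
  (anomaliesUnderVerification : Nat)
  outputSha256 : String
  deriving Repr, DecidableEq

/-- DATA (not a theorem): `JOIN-HEIGHTFREE.summary.json (gen 7, table of record): counts / inputs.lean_atlas / output`. -/
def heightFreeG7 : HeightFreeJoin :=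
  { atlasFiles := 79, atlasDefs := 2261, atlasCurves := 1977, cells := 3648, cellsRankTwo := 3088, cellsRankThree := 560,
    pFive := 1446, pSeven := 1491, pEleven := 538, pThirteen := 173, unitAgree := 3648, cleanUnitCells := 2919,
    cleanRankTwo := 2460, cleanRankThree := 459, cleanPFive := 888, cleanPSeven := 1336, cleanPEleven := 526, cleanPThirteen := 169,
    cleanUnitCurves := 1776, naAnomalous := 363, naNonUnit := 277, naPTam := 171, naGalrepNonsurjective := 5, naSurjNotCertified := 3,
    tPass := 3285, pPass := 2919, pCheckedValues := 17077, kuriharaBoth := 2488, kuriharaHeightFreeOnly := 431, consistent := 3648,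
    anomaliesUnderVerification := 0, outputSha256 := "354fad98bed6222f" }

/-- DATA (not a theorem): `JOIN-HEIGHTFREE-g8.summary.json (gen 8 refresh): counts / inputs.lean_atlas / output`. -/
def heightFreeG8 : HeightFreeJoin :=
  { atlasFiles := 80, atlasDefs := 2267, atlasCurves := 1983, cells := 3668, cellsRankTwo := 3088, cellsRankThree := 580,
    pFive := 1450, pSeven := 1497, pEleven := 542, pThirteen := 179, unitAgree := 3668, cleanUnitCells := 2936,
    cleanRankTwo := 2460, cleanRankThree := 476, cleanPFive := 889, cleanPSeven := 1342, cleanPEleven := 530, cleanPThirteen := 175,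
    cleanUnitCurves := 1782, naAnomalous := 366, naNonUnit := 279, naPTam := 171, naGalrepNonsurjective := 5, naSurjNotCertified := 3,
    tPass := 3302, pPass := 2936, pCheckedValues := 17162, kuriharaBoth := 2489, kuriharaHeightFreeOnly := 447, consistent := 3668,
    anomaliesUnderVerification := 0, outputSha256 := "5e8378b744471202" }

/-- Bookkeeping of one J9 run: rank and prime splits, unit flag agreement on every cell, T = non-anomalous cells, P = clean cells,
Kurihara split of the clean cells, no anomaly. -/
def HeightFreeJoin.bookkeeping (h : HeightFreeJoin) : Prop :=
  h.cellsRankTwo + h.cellsRankThree = h.cells ∧ h.pFive + h.pSeven + h.pEleven + h.pThirteen = h.cells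
  ∧ h.cleanRankTwo + h.cleanRankThree = h.cleanUnitCells ∧ h.cleanPFive + h.cleanPSeven + h.cleanPEleven + h.cleanPThirteen = h.cleanUnitCells
  ∧ h.unitAgree = h.cells ∧ h.consistent = h.cells ∧ h.tPass + h.naAnomalous = h.cells ∧ h.pPass = h.cleanUnitCells
  ∧ h.kuriharaBoth + h.kuriharaHeightFreeOnly = h.cleanUnitCells ∧ h.cleanUnitCurves ≤ h.atlasCurves ∧ h.anomaliesUnderVerification = 0

/-- `HeightFreeJoin.bookkeeping` is a conjunction of `Nat` (in)equalities, hence decidable. -/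
instance (h : HeightFreeJoin) : Decidable h.bookkeeping := by unfold HeightFreeJoin.bookkeeping; infer_instance

example : heightFreeG7.bookkeeping ∧ heightFreeG8.bookkeeping := by decide
/-- The refresh only grows: one more atlas file, rank-2 cells unchanged, rank-3 cells / clean cells / curves grow. -/
example : heightFreeG8.atlasFiles = heightFreeG7.atlasFiles + 1 ∧ heightFreeG8.cellsRankTwo = heightFreeG7.cellsRankTwo
    ∧ heightFreeG8.cleanRankTwo = heightFreeG7.cleanRankTwo ∧ heightFreeG7.cellsRankThree + 20 = heightFreeG8.cellsRankThree
    ∧ heightFreeG7.cleanUnitCells + 17 = heightFreeG8.cleanUnitCells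
    ∧ heightFreeG7.cleanUnitCurves + 6 = heightFreeG8.cleanUnitCurves := by decide

/-! ## J4-g8 / J5-g8 / J6-g8 — Kurihara-lane refresh (lane snapshot 2026-08-20T21:38:29Z: 395 145 lines, sha256-as-streamed `1463076e3ec59813…`,
N ≤ 59 998)

Same scripts and checks as J4/J5/J6 (gen 4) and their g6 refresh (Kim, Amer. J. Math. 148, Thm 1.8, every hypothesis recomputed); only the
lane input grew. The gen-4 tables of record and the `-g6` refresh are kept; the gen-8 refresh is published with the suffix `-g8`
(`JOIN-KURIHARA-g8.*`, `SHA-PINF-CERTIFIED-g8.tsv` sha256 `b8375df8d453db97…`, `JOIN-KURIHARA-LOCAL-g8.*`, `j5impl2-j107961/`,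
`JOIN-KURIHARA-PADIC-g8.*`). -/

/-- DATA (not a theorem): J4-g8 lane records `(E, p, n)` joined and consistent, by prime and by rank; class-mate rows; census classes
(`N ≤ 59 998`) with at least one certificate; census curves with `Ш(E)[p^∞] = 0` proved at `k` of the primes 5, 7, 11, 13 (digest
`SHA-PINF-CERTIFIED-g8.tsv`); mismatches. -/
structure KuriharaRefresh where
  (laneRows laneRowsRankTwo laneRowsRankThree consistent pFive pSeven : Nat)
  (pEleven pThirteen goodOrdinary goodSupersingular anomalous serreWitnessAndGalrep : Nat)
  (classMateRows classMateConsistent classesWithCertRankTwo classesRankTwoInRange classesWithCertRankThree curvesCertifiedRankTwo : Nat)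
  (curvesCertifiedRankThree kOne kTwo kThree kFour mismatches : Nat)
  outputSha256 : String
  digestSha256 : String
  deriving Repr, DecidableEq

/-- DATA (not a theorem): `JOIN-KURIHARA-g8.summary.json: counts / classmate_counts / coverage`. -/
def kuriharaRefreshG8 : KuriharaRefresh :=
  { laneRows := 59598, laneRowsRankTwo := 59494, laneRowsRankThree := 104, consistent := 59598, pFive := 12304, pSeven := 14826, pEleven := 16473,
    pThirteen := 15995, goodOrdinary := 51813, goodSupersingular := 7785, anomalous := 4631, serreWitnessAndGalrep := 59598, classMateRows := 12008,
    classMateConsistent := 12008, classesWithCertRankTwo := 20627, classesRankTwoInRange := 24012, classesWithCertRankThree := 91,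
    curvesCertifiedRankTwo := 25223, curvesCertifiedRankThree := 92, kOne := 1728, kTwo := 6747, kThree := 10976, kFour := 5864, mismatches := 0,
    outputSha256 := "64074b8376666914", digestSha256 := "b8375df8d453db97" }

example : kuriharaRefreshG8.consistent = kuriharaRefreshG8.laneRows ∧ kuriharaRefreshG8.mismatches = 0
    ∧ kuriharaRefreshG8.laneRowsRankTwo + kuriharaRefreshG8.laneRowsRankThree = kuriharaRefreshG8.laneRows
    ∧ kuriharaRefreshG8.pFive + kuriharaRefreshG8.pSeven + kuriharaRefreshG8.pEleven + kuriharaRefreshG8.pThirteen = kuriharaRefreshG8.laneRows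
    ∧ kuriharaRefreshG8.goodOrdinary + kuriharaRefreshG8.goodSupersingular = kuriharaRefreshG8.laneRows
    ∧ kuriharaRefreshG8.serreWitnessAndGalrep = kuriharaRefreshG8.laneRows ∧ kuriharaRefreshG8.classMateConsistent = kuriharaRefreshG8.classMateRows
    ∧ kuriharaRefreshG8.kOne + kuriharaRefreshG8.kTwo + kuriharaRefreshG8.kThree + kuriharaRefreshG8.kFour
      = kuriharaRefreshG8.curvesCertifiedRankTwo + kuriharaRefreshG8.curvesCertifiedRankThree := by decide

/-- DATA (not a theorem): row-level regression of a refresh (`REFRESH-REGRESSION-*.json`): per table, old keys, old keys reappearing in the new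
table with the identical verdict columns, new keys; J5 old informational zero-level rows retired because the lane certified the pair since;
digest prime sets equal / strictly grown / shrunk; curves new in the new digest. -/
structure RefreshRegression where
  (jFourOld jFourIdentical jFourNew jFiveOld jFiveIdentical jFiveRetiredZeroLevels : Nat)
  (jSixOld jSixIdentical digestOld digestIdentical digestPrimeSetsEqual digestPrimeSetsGrown : Nat)
  (digestPrimeSetsShrunk digestNewCurves : Nat)
  deriving Repr, DecidableEq

/-- DATA (not a theorem): `REFRESH-REGRESSION-g8.json (gen-4 tables of record → g8): tables / digest_prime_sets` (verdict: PASS). -/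
def regressionRecordToG8 : RefreshRegression :=
  { jFourOld := 63263, jFourIdentical := 63263, jFourNew := 71606, jFiveOld := 56655, jFiveIdentical := 56571, jFiveRetiredZeroLevels := 84,
    jSixOld := 28742, jSixIdentical := 28742, digestOld := 23224, digestIdentical := 23224, digestPrimeSetsEqual := 20109, digestPrimeSetsGrown := 3115,
    digestPrimeSetsShrunk := 0, digestNewCurves := 2091 }

/-- DATA (not a theorem): `REFRESH-REGRESSION-g6-g8.json (g6 refresh → g8): tables / digest_prime_sets` (verdict: PASS). -/
def regressionG6ToG8 : RefreshRegression :=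
  { jFourOld := 70312, jFourIdentical := 70312, jFourNew := 71606, jFiveOld := 62435, jFiveIdentical := 62418, jFiveRetiredZeroLevels := 17,
    jSixOld := 31272, jSixIdentical := 31272, digestOld := 25096, digestIdentical := 25096, digestPrimeSetsEqual := 24386, digestPrimeSetsGrown := 710,
    digestPrimeSetsShrunk := 0, digestNewCurves := 219 }

/-- Bookkeeping of one regression: every old J4 / J6 / digest key identical, J5 identical up to the retired zero levels, no prime set shrunk,
the new J4 table is the refreshed lane + class-mate rows and the new digest is the refreshed certified-curve count. -/
def RefreshRegression.passes (g : RefreshRegression) (k : KuriharaRefresh) : Prop :=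
  g.jFourIdentical = g.jFourOld ∧ g.jSixIdentical = g.jSixOld ∧ g.jFiveIdentical + g.jFiveRetiredZeroLevels = g.jFiveOld
  ∧ g.digestIdentical = g.digestOld ∧ g.digestPrimeSetsShrunk = 0 ∧ g.digestPrimeSetsEqual + g.digestPrimeSetsGrown = g.digestOld
  ∧ g.jFourNew = k.laneRows + k.classMateRows ∧ g.digestOld + g.digestNewCurves = k.curvesCertifiedRankTwo + k.curvesCertifiedRankThree

/-- `RefreshRegression.passes` is a conjunction of `Nat` equalities, hence decidable. -/
instance (g : RefreshRegression) (k : KuriharaRefresh) : Decidable (g.passes k) := by unfold RefreshRegression.passes; infer_instance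

example : regressionRecordToG8.passes kuriharaRefreshG8 ∧ regressionG6ToG8.passes kuriharaRefreshG8 := by decide

/-- DATA (not a theorem): J5-g8 — local conditions at the Kolyvagin primes on the refreshed lane (fields as `AnomJoins4.kuriharaLocalRefresh`):
levels (lane hits + zero levels), cyclic Kolyvagin prime slots of certified levels (total, by p), certified levels with the Kim-Thm-1.11
hypotheses true and the reduction map an isomorphism, anomalous levels (reported, no theorem invoked), certified levels with `M` SINGULAR
(would be an anomaly), zero levels non-cyclic / cyclic-singular / cyclic-nonsingular, zero pairs all locally obstructed; implementation 2
(PARI job j107961): levels compared, `#E(F_ℓ)` / structures / singular-vs-nonsingular / rank agree, error rows. -/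
structure KuriharaLocalRefresh where
  (levels laneHits zeroLevels cyclicSlots cyclicSlotsPFive cyclicSlotsPSeven : Nat)
  (cyclicSlotsPEleven cyclicSlotsPThirteen isomorphismVerified anomalousObserved certifiedSingular zeroNonCyclic : Nat)
  (zeroCyclicSingular zeroCyclicNonsingular zeroPairsObstructed zeroPairs implTwoLevels implTwoCardAgree : Nat)
  (implTwoStructureAgree implTwoSingularityAgree implTwoRankAgree implTwoErrorRows anomaliesUnderVerification : Nat)
  outputSha256 : String
  deriving Repr, DecidableEq

/-- DATA (not a theorem): `JOIN-KURIHARA-LOCAL-g8.summary.json: counts` and `j5impl2-j107961/J5-IMPL2-AGREEMENT.json: counts`. -/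
def kuriharaLocalRefreshG8 : KuriharaLocalRefresh :=
  { levels := 63521, laneHits := 59598, zeroLevels := 3923, cyclicSlots := 119300, cyclicSlotsPFive := 24672, cyclicSlotsPSeven := 29671,
    cyclicSlotsPEleven := 32965, cyclicSlotsPThirteen := 31992, isomorphismVerified := 54967, anomalousObserved := 4631, certifiedSingular := 0,
    zeroNonCyclic := 1947, zeroCyclicSingular := 1976, zeroCyclicNonsingular := 0, zeroPairsObstructed := 1407, zeroPairs := 1407,
    implTwoLevels := 63521, implTwoCardAgree := 63521, implTwoStructureAgree := 63521, implTwoSingularityAgree := 61574, implTwoRankAgree := 61574,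
    implTwoErrorRows := 0, anomaliesUnderVerification := 0, outputSha256 := "6798db7b8eac95ad" }

example : kuriharaLocalRefreshG8.laneHits = kuriharaRefreshG8.laneRows
    ∧ kuriharaLocalRefreshG8.laneHits + kuriharaLocalRefreshG8.zeroLevels = kuriharaLocalRefreshG8.levels
    ∧ kuriharaLocalRefreshG8.cyclicSlotsPFive + kuriharaLocalRefreshG8.cyclicSlotsPSeven + kuriharaLocalRefreshG8.cyclicSlotsPEleven
      + kuriharaLocalRefreshG8.cyclicSlotsPThirteen = kuriharaLocalRefreshG8.cyclicSlots
    ∧ kuriharaLocalRefreshG8.isomorphismVerified + kuriharaLocalRefreshG8.anomalousObserved = kuriharaLocalRefreshG8.laneHits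
    ∧ kuriharaLocalRefreshG8.certifiedSingular = 0 ∧ kuriharaLocalRefreshG8.zeroCyclicNonsingular = 0
    ∧ kuriharaLocalRefreshG8.zeroNonCyclic + kuriharaLocalRefreshG8.zeroCyclicSingular = kuriharaLocalRefreshG8.zeroLevels
    ∧ kuriharaLocalRefreshG8.zeroPairsObstructed = kuriharaLocalRefreshG8.zeroPairs
    ∧ kuriharaLocalRefreshG8.implTwoLevels = kuriharaLocalRefreshG8.levels ∧ kuriharaLocalRefreshG8.implTwoCardAgree = kuriharaLocalRefreshG8.levels
    ∧ kuriharaLocalRefreshG8.implTwoStructureAgree = kuriharaLocalRefreshG8.levels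
    ∧ kuriharaLocalRefreshG8.implTwoSingularityAgree = kuriharaLocalRefreshG8.laneHits + kuriharaLocalRefreshG8.zeroCyclicSingular
    ∧ kuriharaLocalRefreshG8.implTwoRankAgree = kuriharaLocalRefreshG8.implTwoSingularityAgree
    ∧ kuriharaLocalRefreshG8.implTwoErrorRows = 0 ∧ kuriharaLocalRefreshG8.anomaliesUnderVerification = 0 := by decide

/-- DATA (not a theorem): J6-g8 — cells `(E, p)` carrying all three of census `S`, a p-adic instrument reading (J2.3, `JOIN-PADIC-g5`) and a
Kurihara certificate (J4-g8): cells by tier and by prime, curves, p-adic two-engine cells, cells consistent on all three. -/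
structure TripleCellsRefresh where
  (cells cellsRTwoA cellsRTwoC cellsRThreeA pFive pSeven : Nat)
  (pEleven pThirteen curves padicTwoEngineCells tripleConsistent : Nat)
  outputSha256 : String
  deriving Repr, DecidableEq

/-- DATA (not a theorem): `JOIN-KURIHARA-PADIC-g8.summary.json: counts`. -/
def tripleCellsRefreshG8 : TripleCellsRefresh :=
  { cells := 31989, cellsRTwoA := 5799, cellsRTwoC := 26086, cellsRThreeA := 104, pFive := 6246, pSeven := 8222, pEleven := 8538, pThirteen := 8983,
    curves := 12910, padicTwoEngineCells := 2885, tripleConsistent := 31989, outputSha256 := "621b08cab68225f8" }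

example : tripleCellsRefreshG8.cellsRTwoA + tripleCellsRefreshG8.cellsRTwoC + tripleCellsRefreshG8.cellsRThreeA
      = tripleCellsRefreshG8.cells
    ∧ tripleCellsRefreshG8.pFive + tripleCellsRefreshG8.pSeven + tripleCellsRefreshG8.pEleven + tripleCellsRefreshG8.pThirteen
      = tripleCellsRefreshG8.cells
    ∧ tripleCellsRefreshG8.tripleConsistent = tripleCellsRefreshG8.cells := by decide

/-! ## J7-g8 — the gen-8 Ш-parts ledger (`SHA-PARTS-LEDGER-g8`: p ≥ 5 digest `SHA-PINF-CERTIFIED-g8.tsv`; NEW separately listed class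
`primes_theorem_named_facts` = the J9-g8 clean unit cells; the gen-5 ledger of record and the g6 ledger are kept unchanged) -/

/-- DATA (not a theorem): gen-8 ledger, per prime: census rows for which `#Ш(E)[p^∞]` is an unconditional theorem (p = 2 descents, p = 3
unconditional descent tokens, p ≥ 5 Kim Thm 1.8 on a unit Kurihara number), rows for which it holds modulo GRH only (p = 3 `GRH_BNF`), and
rows carrying a J9 clean unit cell at p (`#Ш[p^∞] = 1` by `AtlasCurve(3).heightFreeRow` GIVEN the named facts Kato 17.4 + Schneider /
Perrin-Riou and census inputs) — three separate columns, never merged. -/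
structure LedgerByPrime where
  (p unconditional grhOnly heightFreeNamedFacts : Nat)
  deriving Repr, DecidableEq

/-- DATA (not a theorem): `SHA-PARTS-LEDGER-g8.summary.json: primes_unconditional_by_prime / primes_GRH_by_prime /
heightfree_theorem_named_facts.by_prime`. -/
def ledgerByPrimeG8 : List LedgerByPrime := [
  { p := 2, unconditional := 358159, grhOnly := 0, heightFreeNamedFacts := 0 },
  { p := 3, unconditional := 18331, grhOnly := 339810, heightFreeNamedFacts := 0 },
  { p := 5, unconditional := 14660, grhOnly := 0, heightFreeNamedFacts := 889 },
  { p := 7, unconditional := 17816, grhOnly := 0, heightFreeNamedFacts := 1342 },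
  { p := 11, unconditional := 19890, grhOnly := 0, heightFreeNamedFacts := 530 },
  { p := 13, unconditional := 19240, grhOnly := 0, heightFreeNamedFacts := 175 } ]

/-- DATA (not a theorem): gen-8 ledger histogram of the number `k` of primes per row at which `#Ш(E)[p^∞]` is an unconditional theorem
(`k = 1` = only p = 2), the same counting the GRH-conditional p = 3, and — over the rows carrying a height-free cell only — the same counting
all three classes. -/
structure LedgerKHist where
  (k rowsUnconditional rowsWithGrh hfRowsAnyClass : Nat)
  deriving Repr, DecidableEq

/-- DATA (not a theorem): `SHA-PARTS-LEDGER-g8.summary.json: k_unconditional_hist / k_all_hist / heightfree….k_any_source_hist_on_hf_rows`. -/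
def ledgerKHistG8 : List LedgerKHist := [
  { k := 1, rowsUnconditional := 316050, rowsWithGrh := 18, hfRowsAnyClass := 0 },
  { k := 2, rowsUnconditional := 18404, rowsWithGrh := 332826, hfRowsAnyClass := 0 },
  { k := 3, rowsUnconditional := 6398, rowsWithGrh := 1728, hfRowsAnyClass := 19 },
  { k := 4, rowsUnconditional := 10771, rowsWithGrh := 6747, hfRowsAnyClass := 174 },
  { k := 5, rowsUnconditional := 6256, rowsWithGrh := 10976, hfRowsAnyClass := 786 },
  { k := 6, rowsUnconditional := 280, rowsWithGrh := 5864, hfRowsAnyClass := 803 } ]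

/-- DATA (not a theorem): gen-8 ledger totals: rows, rows with all of 5, 7, 11, 13 (unconditional class), rows with at least one prime ≥ 5
(unconditional class), `Ш[3]`-column tokens (unconditional / `GRH_BNF` / n-a), J8 instrument column (`S_A ≡ S` / undetermined deep /
supersingular MT rows), labels with a J2 instrument cell and non-consistent ones, `S = 4` rows (all two-engine `#Ш[2^∞] = 4`); the height-free
class: cells, rows (by rank), cells that are ALSO unconditional J4 theorems at the same (E, p), cells beyond J4, rows with a prime beyond J4,
rows whose first p ≥ 5 theorem route of any kind is the height-free cell, `S = 4` rows with a height-free cell; flags; output sha. -/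
structure LedgerTotalsG8 where
  (rows rowsAllOfFiveSevenElevenThirteen rowsSomePrimeGeFive shaThreeUnconditional shaThreeGrhBnf shaThreeNa : Nat)
  (uThreeSAEqS uThreeUndetermined uThreeSupersingularMt padicInstrumentLabels padicNonConsistent sFourRows : Nat)
  (sFourRowsTwoEngineOrderFour hfCells hfRows hfRowsRankTwo hfRowsRankThree hfCellsAlsoJFour : Nat)
  (hfCellsBeyondJFour hfRowsWithPrimeBeyondJFour hfRowsFirstRoute sFourRowsWithHf flags : Nat)
  outputSha256 : String
  deriving Repr, DecidableEq

/-- DATA (not a theorem): `SHA-PARTS-LEDGER-g8.summary.json` totals (`census`, `prime_set_hist`, `p3.tokens`, `u3_instrument`, `padic_instrument`,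
`heightfree_theorem_named_facts.counts`, `S4_rows`, `n_flags`, `outputs`). -/
def ledgerTotalsG8 : LedgerTotalsG8 :=
  { rows := 358159, rowsAllOfFiveSevenElevenThirteen := 5864, rowsSomePrimeGeFive := 25315, shaThreeUnconditional := 18331, shaThreeGrhBnf := 339810,
    shaThreeNa := 18, uThreeSAEqS := 13496, uThreeUndetermined := 1, uThreeSupersingularMt := 6682, padicInstrumentLabels := 16774,
    padicNonConsistent := 0, sFourRows := 42, sFourRowsTwoEngineOrderFour := 42, hfCells := 2936, hfRows := 1782, hfRowsRankTwo := 1612,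
    hfRowsRankThree := 170, hfCellsAlsoJFour := 2490, hfCellsBeyondJFour := 446, hfRowsWithPrimeBeyondJFour := 198, hfRowsFirstRoute := 93,
    sFourRowsWithHf := 0, flags := 0, outputSha256 := "0bdb34bc8806e242" }

example : (ledgerKHistG8.map (·.rowsUnconditional)).sum = ledgerTotalsG8.rows ∧ (ledgerKHistG8.map (·.rowsWithGrh)).sum = ledgerTotalsG8.rows
    ∧ ledgerTotalsG8.rows = 358159 ∧ (ledgerKHistG8.map (·.hfRowsAnyClass)).sum = ledgerTotalsG8.hfRows
    ∧ ledgerTotalsG8.shaThreeUnconditional + ledgerTotalsG8.shaThreeGrhBnf + ledgerTotalsG8.shaThreeNa = ledgerTotalsG8.rows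
    ∧ (ledgerByPrimeG8.filter (·.p = 3)).map (·.unconditional) = [ledgerTotalsG8.shaThreeUnconditional]
    ∧ (ledgerByPrimeG8.filter (·.p = 3)).map (·.grhOnly) = [ledgerTotalsG8.shaThreeGrhBnf]
    ∧ (ledgerByPrimeG8.filter (·.p = 2)).map (·.unconditional) = [ledgerTotalsG8.rows]
    ∧ (ledgerByPrimeG8.map (·.heightFreeNamedFacts)).sum = ledgerTotalsG8.hfCells
    ∧ ledgerTotalsG8.hfCellsAlsoJFour + ledgerTotalsG8.hfCellsBeyondJFour = ledgerTotalsG8.hfCells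
    ∧ ledgerTotalsG8.hfRowsRankTwo + ledgerTotalsG8.hfRowsRankThree = ledgerTotalsG8.hfRows
    ∧ ledgerTotalsG8.hfRowsFirstRoute ≤ ledgerTotalsG8.hfRowsWithPrimeBeyondJFour ∧ ledgerTotalsG8.sFourRowsWithHf = 0
    ∧ ledgerTotalsG8.flags = 0 ∧ ledgerTotalsG8.padicNonConsistent = 0
    ∧ ledgerTotalsG8.sFourRowsTwoEngineOrderFour = ledgerTotalsG8.sFourRows := by decide
/-- Bookkeeping across the blocks of this file: the height-free class of the ledger is the J9-g8 join (cells = clean unit cells, rows = clean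
unit curves, by prime); the unconditional p ≥ 5 rows of the ledger are the J4-g8 digest. -/
example : ledgerTotalsG8.hfCells = heightFreeG8.cleanUnitCells ∧ ledgerTotalsG8.hfRows = heightFreeG8.cleanUnitCurves
    ∧ (ledgerByPrimeG8.filter (5 ≤ ·.p)).map (·.heightFreeNamedFacts)
      = [heightFreeG8.cleanPFive, heightFreeG8.cleanPSeven, heightFreeG8.cleanPEleven, heightFreeG8.cleanPThirteen]
    ∧ ledgerTotalsG8.rowsSomePrimeGeFive = kuriharaRefreshG8.curvesCertifiedRankTwo + kuriharaRefreshG8.curvesCertifiedRankThree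
    ∧ ledgerTotalsG8.rowsAllOfFiveSevenElevenThirteen = kuriharaRefreshG8.kFour := by decide

end Summit.BirchSwinnertonDyer.BirchSwinnertonDyer.Rank2Observatory.AnomJoins5
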